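import Mathlib
import Summits.SmoothPoincare4.SmoothPoincare4.Theorems.CylinderEntropyCylinderRungTwoKCertSoundPt
import HarnessLib

/-!
# Kernel certificate checker for `stub_certMid`, VIII-b: the zonal range and the per-atom box enclosures

Infrastructure file for the kernel-clean discharge of the registered stub `stub_certMid` of crux stmt-SmoothPoincare4-7631
(`Summit.SmoothPoincare4.SmoothPoincare4.Theses.CylinderEntropy.CylinderRungTwo`, line `killing-flux`).  On a box
`[u₁, u₂] × [θ̂₁, θ̂₂]` the zonal factor of an atom lies in `zRange` (monotonicity, tangent minorants, grid-cell lower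
bounds, convexity majorant); hence `atomBox` / `atomsBox` bound `Σ w_j G_j Z_j` from below and enclose the two partial
derivatives of `R`.  No named facts.
-/

-- the registered namespace `Summit.SmoothPoincare4.SmoothPoincare4.…` repeats a component
set_option linter.dupNamespace false

noncomputable section

namespace Summit.SmoothPoincare4.SmoothPoincare4.Cruxes.CylinderRungTwo.KillingFlux

namespace KCert


open Set
open Literature.Analysis.ValidatedNumerics.NumericsMP
open Summit.SmoothPoincare4.SmoothPoincare4.Theorems.CylinderEntropySliceIsolation
open Summit.SmoothPoincare4.SmoothPoincare4.Theorems.CylinderEntropySliceIsolation.Cert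

variable (C : KCell)

/-! ### `zRange` -/

/-- Index comparison from angle comparison on a validated grid: `θ_i ≤ θ_j`, `i, j < N` gives `i ≤ j`. [folklore] -/
theorem idx_le_of_th_le (hg : gridOK C = true) {i j : ℕ} (hi : i < C.grid.length) (h : C.th i ≤ C.th j) : i ≤ j := by
  by_contra hlt
  rw [not_le] at hlt
  have h1 : C.th j < C.th (j + 1) := theta_lt_succ C hg (by omega)
  have h2 : C.th (j + 1) ≤ C.th i := theta_mono C hg (by omega) hi
  exact absurd h (not_le.2 (h1.trans_le h2))

/-- A grid cell containing `θ ∈ [θ_{i₀}, θ_{j})`: some `i` with `i₀ ≤ i < j` and `θ_i ≤ θ ≤ θ_{i+1}`. [folklore] -/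
theorem exists_cell {i₀ j : ℕ} {θ : ℝ} (h1 : C.th i₀ ≤ θ) (h2 : θ < C.th j) (hij : i₀ < j) :
    ∃ i, i₀ ≤ i ∧ i < j ∧ C.th i ≤ θ ∧ θ ≤ C.th (i + 1) := by
  classical
  set P : ℕ → Prop := fun i => C.th i ≤ θ with hP
  set i := Nat.findGreatest P (j - 1) with hi
  have hi₀ : i₀ ≤ j - 1 := by omega
  have hmem : i₀ ≤ i := Nat.le_findGreatest hi₀ h1
  have hle : i ≤ j - 1 := Nat.findGreatest_le _
  have hPi : P i := Nat.findGreatest_spec hi₀ h1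
  refine ⟨i, hmem, by omega, hPi, ?_⟩
  by_cases hij' : i + 1 ≤ j - 1
  · have : ¬P (i + 1) := Nat.findGreatest_is_greatest (by omega) hij'
    exact le_of_lt (not_le.1 this)
  · have : i + 1 = j := by omega
    rw [this]; exact h2.le

/-- **The zonal factor of an atom on a box lies in `zRange`**, and `0 ≤ zRange.lo`. Hypotheses: the per-atom pieces of
`TDok` at the two `θ`-ends, `θ ∈ [θ̂₁, θ̂₂]`, `θ ≤ π`, and `t₁ ≤ π` (the box is nonempty). [folklore] -/
theorem zRange_spec {a : KAtom} (ha : atomOK C a = true) (hg : gridOK C = true) {tab : List TabE} (htab : TabOK C a tab)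
    {T1 T2 : TD} (ht1 : 0 ≤ T1.t) (ht2 : 0 ≤ T2.t) (hia1 : T1.ia < C.grid.length) (hib1 : T1.ib < C.grid.length)
    (hia2 : T2.ia < C.grid.length) (hθa1 : C.th T1.ia ≤ T1.th) (hθb1 : T1.th ≤ C.th T1.ib)
    {tfl1 tfl2 hup1 : ℤ} (hf1 : 0 ≤ tfl1 ∧ ((tfl1 : ℤ) : ℝ) ≤ a.Zc T1.th * S64)
    (hf2 : 0 ≤ tfl2 ∧ ((tfl2 : ℤ) : ℝ) ≤ a.Zc T2.th * S64)
    (hh1 : Real.exp (-(T1.t : ℝ) ^ 2 / (4 * a.tau)) * S64 ≤ ((hup1 : ℤ) : ℝ)) (hπ1 : (T1.t : ℝ) ≤ Real.pi)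
    {θ : ℝ} (hθ1 : T1.th ≤ θ) (hθ2 : θ ≤ T2.th) :
    MI.mem S64 (a.Zc θ) (zRange tab T1 T2 tfl1 tfl2 hup1) ∧ 0 ≤ (zRange tab T1 T2 tfl1 tfl2 hup1).lo := by
  obtain ⟨hlen, hsp⟩ := htab
  have hS := S64_cast_pos.2
  have hT1 := TD.th_mem ht1
  have hT2 := TD.th_mem ht2
  have hθ0 : 0 ≤ θ := hT1.1.trans hθ1
  have hθπ : θ ≤ Real.pi := hθ2.trans hT2.2
  have hth1 : T1.th = (T1.t : ℝ) := min_eq_left hπ1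
  -- `Zc θ ≥ Zc θ̂₂ ≥ tfl2`
  have hlo2 : ((tfl2 : ℤ) : ℝ) ≤ a.Zc θ * S64 :=
    hf2.2.trans (mul_le_mul_of_nonneg_right (Zc_antitone C ha hθ0 hθ2 hT2.2) hS.le)
  -- grid angles are in `[0, π]`
  obtain ⟨_, hpt, _⟩ := gridOK_sound C hg
  have hgθ : ∀ i, i < C.grid.length → 0 ≤ C.th i ∧ C.th i ≤ Real.pi := fun i hi =>
    ⟨le_trans (by exact_mod_cast (hpt i hi).2.2.1) (hpt i hi).2.2.2.1, (hpt i hi).2.2.2.2.2⟩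
  -- upper bounds at `θ̂₁`
  have hZ1 : a.Zc θ ≤ a.Zc T1.th := Zc_antitone C ha hT1.1 hθ1 hθπ
  have hMono : a.Zc T1.th * S64 ≤ ((zhi64 (tab.getD T1.ia tabD).zhi : ℤ) : ℝ) := by
    refine le_zhi64_of_le (le_trans (Zc_antitone C ha (hgθ _ hia1).1 hθa1 hT1.2) ?_)
    exact (hsp T1.ia hia1).2.2.1
  have hConv : a.Zc T1.th * S64 ≤ ((cdivZ (hup1 * maxExpfS tab T1.ia T1.ib) S64 : ℤ) : ℝ) := by
    have hSz : (0 : ℤ) < (S64 : ℤ) := by exact_mod_cast S64_pos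
    refine le_trans ?_ (le_cdivZ_real _ hSz)
    push_cast
    rw [le_div_iff₀ hS]
    have hab : T1.ia ≤ T1.ib := idx_le_of_th_le C hg hia1 (hθa1.trans hθb1)
    obtain ⟨hea, hM0⟩ := le_maxExpfS tab le_rfl hab (by omega)
    obtain ⟨heb, _⟩ := le_maxExpfS tab hab le_rfl (by omega)
    -- `e^{f θ̂₁} S ≤ maxExpfS`
    have hef : Real.exp (a.f T1.th) * S64 ≤ ((maxExpfS tab T1.ia T1.ib : ℤ) : ℝ) := by
      have hfm := f_le_max C ha hθa1 hθb1
      rcases le_total (a.f (C.th T1.ia)) (a.f (C.th T1.ib)) with hc | hc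
      · rw [max_eq_right hc] at hfm
        refine le_trans (mul_le_mul_of_nonneg_right (Real.exp_le_exp.2 hfm) hS.le) ?_
        refine le_trans (le_zhi64_of_le (hsp T1.ib hib1).2.2.2.2.2.2.2.2) ?_
        exact_mod_cast heb
      · rw [max_eq_left hc] at hfm
        refine le_trans (mul_le_mul_of_nonneg_right (Real.exp_le_exp.2 hfm) hS.le) ?_
        refine le_trans (le_zhi64_of_le (hsp T1.ia hia1).2.2.2.2.2.2.2.2) ?_
        exact_mod_cast hea
    have hZeq : a.Zc T1.th = Real.exp (a.f T1.th) * Real.exp (-(T1.t : ℝ) ^ 2 / (4 * a.tau)) := by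
      rw [Zc_eq_exp C ha, ← Real.exp_add, hth1]; ring_nf
    have hM0r : (0 : ℝ) ≤ ((maxExpfS tab T1.ia T1.ib : ℤ) : ℝ) := by exact_mod_cast hM0
    calc a.Zc T1.th * S64 * S64 = (Real.exp (a.f T1.th) * S64) * (Real.exp (-(T1.t : ℝ) ^ 2 / (4 * a.tau)) * S64) := by
          rw [hZeq]; ring
      _ ≤ ((maxExpfS tab T1.ia T1.ib : ℤ) : ℝ) * ((hup1 : ℤ) : ℝ) :=
          mul_le_mul hef hh1 (by positivity) hM0r
      _ = ((hup1 : ℤ) : ℝ) * ((maxExpfS tab T1.ia T1.ib : ℤ) : ℝ) := by ring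
  have hhi : a.Zc θ * S64 ≤ ((min (zhi64 (tab.getD T1.ia tabD).zhi) (cdivZ (hup1 * maxExpfS tab T1.ia T1.ib) S64) : ℤ) : ℝ) := by
    have h := mul_le_mul_of_nonneg_right hZ1 hS.le
    push_cast
    exact le_min (h.trans hMono) (h.trans hConv)
  -- nonnegativity of the table quantities
  have hcell0 : ∀ e ∈ tab, 0 ≤ zlo64 e.cello := by
    intro e he
    obtain ⟨i, hi, rfl⟩ := List.mem_iff_getElem.1 he
    have := (hsp i (by omega)).2.2.2.2.2.2.1
    rw [List.getD_eq_getElem _ _ hi] at this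
    exact Int.floor_nonneg.2 (mul_nonneg (by exact_mod_cast this) (by norm_num [S64]))
  have hz0 : 0 ≤ zlo64 (tab.getD T2.ia tabD).zlo :=
    Int.floor_nonneg.2 (mul_nonneg (by exact_mod_cast (hsp T2.ia hia2).1) (by norm_num [S64]))
  unfold zRange
  dsimp only
  split_ifs with heq
  · exact ⟨⟨(by push_cast; exact (min_le_right _ _).trans hlo2), hhi⟩, le_min hf1.1 hf2.1⟩
  · refine ⟨⟨?_, hhi⟩, le_min (le_min hf1.1 hf2.1) ?_⟩
    · push_cast
      rcases le_or_gt (C.th T2.ia) θ with hc | hc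
      · exact (min_le_left _ _).trans ((min_le_right _ _).trans hlo2)
      · -- `θ ∈ [θ_{ia1}, θ_{ia2})`: a grid cell `i ∈ [ia1, ia2)` contains `θ`
        have hlt : T1.ia < T2.ia := by
          have hle : T1.ia ≤ T2.ia := idx_le_of_th_le C hg hia1 ((hθa1.trans hθ1).trans hc.le)
          exact lt_of_le_of_ne hle heq
        obtain ⟨i, hi1, hi2, hc1, hc2⟩ := exists_cell C (hθa1.trans hθ1) hc hlt
        have hiN : i + 1 < C.grid.length := by omega
        have hcello := (hsp i (by omega)).2.2.2.2.2.2.2.1 hiN θ hc1 hc2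
        refine (min_le_right _ _).trans ?_
        exact le_trans (Int.cast_le.2 (minCelloS_le tab (zlo64 (tab.getD T2.ia tabD).zlo) hi1 hi2 (by omega)))
          (zlo64_le_of_le hcello)
    · unfold minCelloS
      exact foldl_min_nonneg _ _ hz0 fun e he => hcell0 e (List.drop_subset _ _ (List.take_subset _ _ he))

/-! ### `atomBox` -/

/-- **The per-atom box enclosures.** For an atom with validated table, the per-atom pieces of `UDok`/`TDok` at the four
ends, and a point `(u, θ)` of the (nonempty) box: the value lower bound and the two derivative enclosures. [folklore] -/
theorem atomBox_spec {a : KAtom} (ha : atomOK C a = true) (hg : gridOK C = true) {tab : List TabE} (htab : TabOK C a tab)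
    (B : BoxD) (ht1 : 0 ≤ B.T1.t) (ht2 : 0 ≤ B.T2.t) (hia1 : B.T1.ia < C.grid.length) (hib1 : B.T1.ib < C.grid.length)
    (hia2 : B.T2.ia < C.grid.length) (hib2 : B.T2.ib < C.grid.length) (hθa1 : C.th B.T1.ia ≤ B.T1.th)
    (hθb1 : B.T1.th ≤ C.th B.T1.ib) (hθb2 : B.T2.th ≤ C.th B.T2.ib)
    {glo1 glo2 ghi1 ghi2 tfl1 tfl2 hup1 : ℤ}
    (hg1 : 0 ≤ glo1 ∧ ((glo1 : ℤ) : ℝ) ≤ a.G B.U1.u * S64) (hg2 : 0 ≤ glo2 ∧ ((glo2 : ℤ) : ℝ) ≤ a.G B.U2.u * S64)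
    (hh1' : a.G B.U1.u * S64 ≤ ((ghi1 : ℤ) : ℝ)) (hh2' : a.G B.U2.u * S64 ≤ ((ghi2 : ℤ) : ℝ))
    (hf1 : 0 ≤ tfl1 ∧ ((tfl1 : ℤ) : ℝ) ≤ a.Zc B.T1.th * S64) (hf2 : 0 ≤ tfl2 ∧ ((tfl2 : ℤ) : ℝ) ≤ a.Zc B.T2.th * S64)
    (hh1 : Real.exp (-(B.T1.t : ℝ) ^ 2 / (4 * a.tau)) * S64 ≤ ((hup1 : ℤ) : ℝ)) (hπ1 : (B.T1.t : ℝ) ≤ Real.pi)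
    {u θ : ℝ} (hu1 : (B.U1.u : ℝ) ≤ u) (hu2 : u ≤ (B.U2.u : ℝ)) (hθ1 : B.T1.th ≤ θ) (hθ2 : θ ≤ B.T2.th) :
    let r := atomBox B a tab glo1 glo2 ghi1 ghi2 tfl1 tfl2 hup1
    ((r.1 : ℤ) : ℝ) ≤ (a.w : ℝ) * a.G u * a.Zc θ * S64 ∧
      MI.mem S64 (a.G u * a.Zc θ * (-(u - a.σ) / (2 * a.tau)) * a.w) r.2.1 ∧
      MI.mem S64 (a.G u * a.Zc θ * (a.fd θ - θ / (2 * a.tau)) * a.w) r.2.2 := by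
  intro r
  have hS := S64_cast_pos.2
  have hSp := S64_pos
  have hτ := tau_pos C ha
  obtain ⟨_, _, hw, htlo, htloτ, hτthi, _⟩ := atomOK_sound C ha
  have htlo0 : (0 : ℝ) < a.tlo := by exact_mod_cast htlo
  have hthi0 : (0 : ℝ) < a.thi := htlo0.trans_le (htloτ.trans hτthi)
  have hT1 := TD.th_mem ht1
  have hT2 := TD.th_mem ht2
  have hθ0 : 0 ≤ θ := hT1.1.trans hθ1
  have hθπ : θ ≤ Real.pi := hθ2.trans hT2.2
  have hth1 : B.T1.th = (B.T1.t : ℝ) := min_eq_left hπ1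
  obtain ⟨hZ, hZ0⟩ := zRange_spec C ha hg htab ht1 ht2 hia1 hib1 hia2 hθa1 hθb1 hf1 hf2 hh1 hπ1 hθ1 hθ2
  -- the Gaussian factor
  have hGlo : ((min glo1 glo2 : ℤ) : ℝ) ≤ a.G u * S64 := by
    have := G_ge_min C ha hu1 hu2
    push_cast
    rcases le_total (a.G B.U1.u) (a.G B.U2.u) with hc | hc
    · rw [min_eq_left hc] at this
      exact (min_le_left _ _).trans (hg1.2.trans (mul_le_mul_of_nonneg_right this hS.le))
    · rw [min_eq_right hc] at this
      exact (min_le_right _ _).trans (hg2.2.trans (mul_le_mul_of_nonneg_right this hS.le))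
  have hGhi : a.G u * S64 ≤ ((if B.U1.u ≤ a.σ ∧ a.σ ≤ B.U2.u then (S64 : ℤ) else max ghi1 ghi2 : ℤ) : ℝ) := by
    split_ifs with hσ
    · push_cast
      have := G_le_one C ha u
      nlinarith
    · have hσ' : ¬(((B.U1.u : ℚ) : ℝ) ≤ (a.σ : ℝ) ∧ ((a.σ : ℚ) : ℝ) ≤ (B.U2.u : ℝ)) := by
        intro h; exact hσ ⟨by exact_mod_cast h.1, by exact_mod_cast h.2⟩
      have := G_le_max C ha hu1 hu2 hσ'
      push_cast
      rcases le_total (a.G B.U1.u) (a.G B.U2.u) with hc | hc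
      · rw [max_eq_right hc] at this
        exact le_trans (mul_le_mul_of_nonneg_right this hS.le) (hh2'.trans (le_max_right _ _))
      · rw [max_eq_left hc] at this
        exact le_trans (mul_le_mul_of_nonneg_right this hS.le) (hh1'.trans (le_max_left _ _))
  have hGmem : MI.mem S64 (a.G u) ⟨min glo1 glo2, if B.U1.u ≤ a.σ ∧ a.σ ≤ B.U2.u then (S64 : ℤ) else max ghi1 ghi2⟩ :=
    ⟨hGlo, hGhi⟩
  have hGZ := MI.mem_mul hSp hGmem hZ
  -- `k = -(u-σ)/(2τ)`
  obtain ⟨hk1, hk2⟩ := kRange_spec C ha hu1 hu2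
  have hK : MI.mem S64 (-(u - a.σ) / (2 * a.tau))
      ⟨zlo64 (-(kRange a B.U1.u B.U2.u).2), zhi64 (-(kRange a B.U1.u B.U2.u).1)⟩ := by
    refine ⟨zlo64_le_of_le ?_, le_zhi64_of_le ?_⟩
    · push_cast; rw [neg_div]; linarith
    · push_cast; rw [neg_div]; linarith
  have hW : MI.mem S64 (a.w : ℝ) (ofQ a.w) := mem_ofQ a.w
  -- `fd θ - θ/(2τ)`
  obtain ⟨_, hsp⟩ := htab
  have hD : MI.mem S64 (a.fd θ - θ / (2 * a.tau))
      ⟨zlo64 ((tab.getD B.T1.ia tabD).mlo - B.T2.t / (2 * a.tlo)), zhi64 ((tab.getD B.T2.ib tabD).mhi - B.T1.t / (2 * a.thi))⟩ := by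
    refine ⟨zlo64_le_of_le ?_, le_zhi64_of_le ?_⟩
    · push_cast
      have h1 : (((tab.getD B.T1.ia tabD).mlo : ℚ) : ℝ) ≤ a.fd θ :=
        (hsp B.T1.ia hia1).2.2.2.2.1.trans (fd_mono C ha (hθa1.trans hθ1))
      have h2 : θ / (2 * a.tau) ≤ (B.T2.t : ℝ) / (2 * a.tlo) := by
        have hθt : θ ≤ (B.T2.t : ℝ) := hθ2.trans (min_le_left _ _)
        calc θ / (2 * a.tau) ≤ θ / (2 * a.tlo) := div_le_div_of_nonneg_left hθ0 (by positivity) (by linarith)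
          _ ≤ (B.T2.t : ℝ) / (2 * a.tlo) := div_le_div_of_nonneg_right hθt (by positivity)
      linarith
    · push_cast
      have h1 : a.fd θ ≤ (((tab.getD B.T2.ib tabD).mhi : ℚ) : ℝ) :=
        (fd_mono C ha (hθ2.trans hθb2)).trans (hsp B.T2.ib hib2).2.2.2.2.2.1
      have h2 : (B.T1.t : ℝ) / (2 * a.thi) ≤ θ / (2 * a.tau) := by
        have hθt : (B.T1.t : ℝ) ≤ θ := hth1 ▸ hθ1
        have ht1' : (0 : ℝ) ≤ B.T1.t := by exact_mod_cast ht1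
        calc (B.T1.t : ℝ) / (2 * a.thi) ≤ θ / (2 * a.thi) := div_le_div_of_nonneg_right hθt (by positivity)
          _ ≤ θ / (2 * a.tau) := div_le_div_of_nonneg_left hθ0 (by positivity) (by linarith)
      linarith
  refine ⟨?_, ?_, ?_⟩
  · -- value
    show ((mul3lo (zlo64 a.w) (min glo1 glo2) (zRange tab B.T1 B.T2 tfl1 tfl2 hup1).lo : ℤ) : ℝ) ≤ _
    have hw0 : 0 ≤ zlo64 a.w := Int.floor_nonneg.2 (mul_nonneg hw (by norm_num [S64]))
    exact mul3lo_le hw0 (le_min hg1.1 hg2.1) hZ0 (zlo64_le a.w) hGlo hZ.1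
  · exact MI.mem_mul hSp (MI.mem_mul hSp hGZ hK) hW
  · exact MI.mem_mul hSp (MI.mem_mul hSp hGZ hD) hW

/-! ### `atomsBox` -/

/-- **The summed box enclosures** (induction over the atoms, all data lists aligned by `Forall₂`). [folklore] -/
theorem atomsBox_spec (hg : gridOK C = true) (B : BoxD) (ht1 : 0 ≤ B.T1.t) (ht2 : 0 ≤ B.T2.t)
    (hia1 : B.T1.ia < C.grid.length) (hib1 : B.T1.ib < C.grid.length) (hia2 : B.T2.ia < C.grid.length)
    (hib2 : B.T2.ib < C.grid.length) (hθa1 : C.th B.T1.ia ≤ B.T1.th) (hθb1 : B.T1.th ≤ C.th B.T1.ib)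
    (hθb2 : B.T2.th ≤ C.th B.T2.ib) (hπ1 : (B.T1.t : ℝ) ≤ Real.pi)
    {u θ : ℝ} (hu1 : (B.U1.u : ℝ) ≤ u) (hu2 : u ≤ (B.U2.u : ℝ)) (hθ1 : B.T1.th ≤ θ) (hθ2 : θ ≤ B.T2.th) :
    ∀ (l : List KAtom) (tabs : List (List TabE)) (g1 g2 h1 h2 f1 f2 hp : List ℤ),
      (∀ a ∈ l, atomOK C a = true) → List.Forall₂ (TabOK C) l tabs →
      List.Forall₂ (fun (a : KAtom) (g : ℤ) => 0 ≤ g ∧ ((g : ℤ) : ℝ) ≤ a.G B.U1.u * S64) l g1 →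
      List.Forall₂ (fun (a : KAtom) (g : ℤ) => 0 ≤ g ∧ ((g : ℤ) : ℝ) ≤ a.G B.U2.u * S64) l g2 →
      List.Forall₂ (fun (a : KAtom) (g : ℤ) => a.G B.U1.u * S64 ≤ ((g : ℤ) : ℝ)) l h1 →
      List.Forall₂ (fun (a : KAtom) (g : ℤ) => a.G B.U2.u * S64 ≤ ((g : ℤ) : ℝ)) l h2 →
      List.Forall₂ (fun (a : KAtom) (f : ℤ) => 0 ≤ f ∧ ((f : ℤ) : ℝ) ≤ a.Zc B.T1.th * S64) l f1 →
      List.Forall₂ (fun (a : KAtom) (f : ℤ) => 0 ≤ f ∧ ((f : ℤ) : ℝ) ≤ a.Zc B.T2.th * S64) l f2 →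
      List.Forall₂ (fun (a : KAtom) (h : ℤ) => Real.exp (-(B.T1.t : ℝ) ^ 2 / (4 * a.tau)) * S64 ≤ ((h : ℤ) : ℝ)) l hp →
      let r := atomsBox B l tabs g1 g2 h1 h2 f1 f2 hp
      ((r.1 : ℤ) : ℝ) ≤ (l.map fun a => (a.w : ℝ) * a.G u * a.Zc θ).sum * S64 ∧
        MI.mem S64 (l.map fun a => a.G u * a.Zc θ * (-(u - a.σ) / (2 * a.tau)) * a.w).sum r.2.1 ∧
        MI.mem S64 (l.map fun a => a.G u * a.Zc θ * (a.fd θ - θ / (2 * a.tau)) * a.w).sum r.2.2 := by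
  intro l
  induction l with
  | nil =>
    intro tabs g1 g2 h1 h2 f1 f2 hp _ htb hg1 hg2 hh1 hh2 hf1 hf2 hhp
    cases htb; cases hg1; cases hg2; cases hh1; cases hh2; cases hf1; cases hf2; cases hhp
    simp [atomsBox, MI.mem]
  | cons a as ih =>
    intro tabs g1 g2 h1 h2 f1 f2 hp hA htb hg1 hg2 hh1 hh2 hf1 hf2 hhp
    cases htb with | cons htb0 htb' =>
    cases hg1 with | cons hg10 hg1' =>
    cases hg2 with | cons hg20 hg2' =>
    cases hh1 with | cons hh10 hh1' =>
    cases hh2 with | cons hh20 hh2' =>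
    cases hf1 with | cons hf10 hf1' =>
    cases hf2 with | cons hf20 hf2' =>
    cases hhp with | cons hhp0 hhp' =>
    intro r
    have hd := atomBox_spec C (hA a (List.mem_cons_self ..)) hg htb0 B ht1 ht2 hia1 hib1 hia2 hib2 hθa1 hθb1 hθb2
      hg10 hg20 hh10 hh20 hf10 hf20 hhp0 hπ1 hu1 hu2 hθ1 hθ2
    have hr := ih _ _ _ _ _ _ _ _ (fun b hb => hA b (List.mem_cons_of_mem _ hb)) htb' hg1' hg2' hh1' hh2' hf1' hf2' hhp'
    simp only [List.map_cons, List.sum_cons]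
    show ((((atomBox B a _ _ _ _ _ _ _ _).1 + (atomsBox B as _ _ _ _ _ _ _ _).1 : ℤ)) : ℝ) ≤ _ ∧
      MI.mem S64 _ ((atomBox B a _ _ _ _ _ _ _ _).2.1.add (atomsBox B as _ _ _ _ _ _ _ _).2.1) ∧
      MI.mem S64 _ ((atomBox B a _ _ _ _ _ _ _ _).2.2.add (atomsBox B as _ _ _ _ _ _ _ _).2.2)
    refine ⟨?_, MI.mem_add hd.2.1 hr.2.1, MI.mem_add hd.2.2 hr.2.2⟩
    push_cast
    rw [add_mul]
    exact add_le_add hd.1 hr.1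

end KCert

/-- Registered sub-goal marker `stub_certMid_part9` of crux stmt-SmoothPoincare4-7631 (helper file 9 of the kernel-clean
`stub_certMid`, line killing-flux): a grid cell containing an angle between two grid angles. [folklore] -/
theorem stub_certMid_part9 : ∀ (C : KCert.KCell) (i₀ j : ℕ) (θ : ℝ), C.th i₀ ≤ θ → θ < C.th j → i₀ < j → ∃ i, i₀ ≤ i ∧ i < j ∧ C.th i ≤ θ ∧ θ ≤ C.th (i + 1) :=
  fun C _ _ _ h1 h2 h3 => KCert.exists_cell C h1 h2 h3

end Summit.SmoothPoincare4.SmoothPoincare4.Cruxes.CylinderRungTwo.KillingFlux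

end
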